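import Literature.LinearAlgebra.Matrix.CyclicVectorCompanionMatrix        -- ★ `exists_conj_eq_of_minpoly_eq_charpoly` (Horn–Johnson 3.3.P12)
import Literature.LinearAlgebra.Matrix.NonderogatoryCommutantBaseChange  -- ★ `minpoly_eq_charpoly_of_charpoly_separable`
import Mathlib.FieldTheory.Minpoly.Field
import Mathlib.RingTheory.Adjoin.Polynomial.Basic
import HarnessLib

/-!
# An isomorphism of the algebras `K[A] ≅ K[B]` generated by two regular semisimple matrices is a conjugation (Horn–Johnson 3.3.P12; Bourbaki A.VII §5)

Topic `LinearAlgebra/Matrix`; namespace `Literature.LinearAlgebra.Matrix`.  THEOREMS ONLY (no definition, no instance, no notation, no named fact, no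
`sorry`).  Cell `pub/hodgecm-mathlib`, crux H413 = `stmt-HodgeConjecture-24833` (supports-only lane), line LH6 «StCharTS», (S-𝔇) datum road, brick (B3)
«SEPARABLE-COMMUTANT-CONJUGATE» of the p03 lineage's «CARTAN-FIN (N1)» road: two Cartan algebras `K[γ]`, `K[γ′]` of `GL_N(K)` (`γ, γ′` regular semisimple)
that are ISOMORPHIC as `K`-algebras are CONJUGATE under `GL_N(K)` — the step «same étale algebra ⇒ stably conjugate tori».

THE MATHEMATICS.  Let `A, B ∈ M_m(K)` have SEPARABLE characteristic polynomials (regular semisimple) and let `φ : K[A] ≃ₐ[K] K[B]` be a `K`-algebra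
isomorphism of the (commutative, `m`-dimensional) subalgebras they generate.  Put `δ := φ(A) ∈ K[B] ⊆ M_m(K)`.  Minimal polynomials are preserved by
injective algebra maps, so `q_δ = q_A = p_A` (the last equality because `p_A` is separable, ★ `minpoly_eq_charpoly_of_charpoly_separable`); hence
`deg q_δ = m`, so `q_δ = p_δ` and `p_δ = p_A`: `A` and `δ` are nonderogatory with the same characteristic polynomial, hence SIMILAR
(★ `exists_conj_eq_of_minpoly_eq_charpoly`, Horn–Johnson 3.3.P12): `δ = S⁻¹ A S`.  Since `φ` and `X ↦ S⁻¹ X S` are `K`-algebra maps agreeing on the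
generator `A`, they agree on `K[A]`: **`exists_conj_eq_algEquiv_adjoin`** — `∃ S ∈ GL_m(K), ∀ x ∈ K[A], φ(x) = S⁻¹ x S` (and the `GL`-packaged form
`exists_gl_conj_eq_algEquiv_adjoin`).  Only the separability of `p_A` is needed (`K[B]` may be any subalgebra receiving `φ`).
Equivalently: `K^m` is free of rank one over `K[A]`, so any two `K[A]`-module structures on `K^m` through algebra embeddings `K[A] ↪ M_m(K)` of
full degree are isomorphic [Bourbaki A.VII §5 no. 4, Cor. 2 of Prop. 7].

## References
* [HornJohnson2013] R. A. Horn, C. R. Johnson, *Matrix Analysis*, 2nd ed. (2013), Thm. 3.3.15 and 3.3.P12 p. 258 (nonderogatory matrices with equal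
  characteristic polynomial are similar).
* [Rogawski1990] J. D. Rogawski, *Automorphic Representations of Unitary Groups in Three Variables*, Ann. of Math. Stud. 123 (1990), §3.5–3.6 pp. 29–31
  (Cartan subgroups `T = {x ∈ L[γ] : x x⋆ = 1}`; stable conjugacy of tori through their algebras).
-/

set_option autoImplicit false

open Polynomial

namespace Literature.LinearAlgebra.Matrix

variable {K : Type*} [Field K] {m : ℕ}

/-- The minimal polynomial of a matrix is that of the corresponding element of any subalgebra containing it. [cite: HornJohnson2013, Thm 3.3.15, p0257] -/
theorem minpoly_coe_matrixSubalgebra (S : Subalgebra K (Matrix (Fin m) (Fin m) K)) (x : ↥S) :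
    minpoly K (x : Matrix (Fin m) (Fin m) K) = minpoly K x :=
  minpoly.algHom_eq S.val Subtype.coe_injective x

/-- **`φ(A)` is nonderogatory with `p_{φ(A)} = p_A`** for `φ : K[A] ≃ₐ[K] S` into a subalgebra `S ⊆ M_m(K)` and `p_A` separable.
[cite: HornJohnson2013, Thm 3.3.15, p0257] -/
theorem minpoly_eq_charpoly_and_charpoly_eq_of_algEquiv (A : Matrix (Fin m) (Fin m) K) (hA : A.charpoly.Separable)
    (S : Subalgebra K (Matrix (Fin m) (Fin m) K))
    (φ : ↥(Algebra.adjoin K ({A} : Set (Matrix (Fin m) (Fin m) K))) ≃ₐ[K] ↥S) :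
    minpoly K ((φ ⟨A, Algebra.self_mem_adjoin_singleton K A⟩ : ↥S) : Matrix (Fin m) (Fin m) K) =
        ((φ ⟨A, Algebra.self_mem_adjoin_singleton K A⟩ : ↥S) : Matrix (Fin m) (Fin m) K).charpoly ∧
      ((φ ⟨A, Algebra.self_mem_adjoin_singleton K A⟩ : ↥S) : Matrix (Fin m) (Fin m) K).charpoly = A.charpoly := by
  set δ : Matrix (Fin m) (Fin m) K := ((φ ⟨A, Algebra.self_mem_adjoin_singleton K A⟩ : ↥S) : Matrix (Fin m) (Fin m) K) with hδ
  -- `q_δ = q_A = p_A`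
  have hqq : minpoly K δ = minpoly K A := by
    rw [hδ, minpoly_coe_matrixSubalgebra S, minpoly.algEquiv_eq φ,
      ← minpoly_coe_matrixSubalgebra (Algebra.adjoin K ({A} : Set (Matrix (Fin m) (Fin m) K))) ⟨A, _⟩]
  have hqA : minpoly K A = A.charpoly := minpoly_eq_charpoly_of_charpoly_separable A hA
  -- `deg q_δ = m`, so `q_δ = p_δ`
  have hdeg : (minpoly K δ).natDegree = Fintype.card (Fin m) := by
    rw [hqq, hqA, Matrix.charpoly_natDegree_eq_dim]
  have hδnd : minpoly K δ = δ.charpoly := (natDegree_minpoly_eq_iff_minpoly_eq_charpoly δ).1 hdeg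
  exact ⟨hδnd, by rw [← hδnd, hqq, hqA]⟩

/-- **An algebra isomorphism `K[A] ≅ K[B]`-type map is a conjugation** (`p_A` separable): for `φ : K[A] ≃ₐ[K] S`, `S ⊆ M_m(K)` a subalgebra, there is an
invertible `P` with `φ(x) = P⁻¹ x P` for every `x ∈ K[A]`. [cite: HornJohnson2013, 3.3.P12, p0258] -/
theorem exists_conj_eq_algEquiv_adjoin (A : Matrix (Fin m) (Fin m) K) (hA : A.charpoly.Separable)
    (S : Subalgebra K (Matrix (Fin m) (Fin m) K))
    (φ : ↥(Algebra.adjoin K ({A} : Set (Matrix (Fin m) (Fin m) K))) ≃ₐ[K] ↥S) :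
    ∃ P : Matrix (Fin m) (Fin m) K, IsUnit P.det ∧
      ∀ x : ↥(Algebra.adjoin K ({A} : Set (Matrix (Fin m) (Fin m) K))), ((φ x : ↥S) : Matrix (Fin m) (Fin m) K) = P⁻¹ * (x : Matrix (Fin m) (Fin m) K) * P := by
  obtain ⟨hδnd, hpp⟩ := minpoly_eq_charpoly_and_charpoly_eq_of_algEquiv A hA S φ
  set δ : Matrix (Fin m) (Fin m) K := ((φ ⟨A, Algebra.self_mem_adjoin_singleton K A⟩ : ↥S) : Matrix (Fin m) (Fin m) K) with hδ
  obtain ⟨P, hP, hconj⟩ := exists_conj_eq_of_minpoly_eq_charpoly A δ (minpoly_eq_charpoly_of_charpoly_separable A hA) hδnd hpp.symm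
  refine ⟨P, hP, fun x => ?_⟩
  -- `x = p(A)` for a polynomial `p`
  obtain ⟨p, hp⟩ : ∃ p : K[X], aeval A p = (x : Matrix (Fin m) (Fin m) K) :=
    (AlgHom.mem_range _).1 ((Algebra.adjoin_singleton_eq_range_aeval K A).le x.2)
  -- `φ(x) = p(φ(A)) = p(δ) = P⁻¹ p(A) P`
  have hxe : x = aeval (⟨A, Algebra.self_mem_adjoin_singleton K A⟩ : ↥(Algebra.adjoin K ({A} : Set (Matrix (Fin m) (Fin m) K)))) p := by
    apply Subtype.ext
    rw [← hp]
    exact Polynomial.aeval_algHom_apply (Algebra.adjoin K ({A} : Set (Matrix (Fin m) (Fin m) K))).val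
      ⟨A, Algebra.self_mem_adjoin_singleton K A⟩ p
  have h1 : ((φ x : ↥S) : Matrix (Fin m) (Fin m) K) = aeval δ p := by
    have e1 : φ.toAlgHom (aeval (⟨A, Algebra.self_mem_adjoin_singleton K A⟩ : ↥(Algebra.adjoin K ({A} : Set (Matrix (Fin m) (Fin m) K)))) p) =
        aeval (φ.toAlgHom ⟨A, Algebra.self_mem_adjoin_singleton K A⟩) p :=
      (Polynomial.aeval_algHom_apply φ.toAlgHom _ p).symm
    have e2 : ((aeval (φ ⟨A, Algebra.self_mem_adjoin_singleton K A⟩) p : ↥S) : Matrix (Fin m) (Fin m) K) = aeval δ p := by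
      rw [hδ]
      exact (Polynomial.aeval_algHom_apply S.val _ p).symm
    rw [hxe, ← e2]
    exact congrArg Subtype.val e1
  rw [h1, hconj, ← hp]
  -- `aeval (P⁻¹ A P) p = P⁻¹ (aeval A p) P`: conjugation is an algebra endomorphism
  have hPP : P * P⁻¹ = 1 := Matrix.mul_nonsing_inv P hP
  have hP'P : P⁻¹ * P = 1 := Matrix.nonsing_inv_mul P hP
  let c : Matrix (Fin m) (Fin m) K →ₐ[K] Matrix (Fin m) (Fin m) K :=
    { toFun := fun X => P⁻¹ * X * P
      map_one' := by rw [Matrix.mul_one, hP'P]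
      map_mul' := fun X Y => by
        calc P⁻¹ * (X * Y) * P = P⁻¹ * X * (P * P⁻¹) * Y * P := by rw [hPP, Matrix.mul_one]; simp only [Matrix.mul_assoc]
          _ = P⁻¹ * X * P * (P⁻¹ * Y * P) := by simp only [Matrix.mul_assoc]
      map_zero' := by rw [Matrix.mul_zero, Matrix.zero_mul]
      map_add' := fun X Y => by rw [Matrix.mul_add, Matrix.add_mul]
      commutes' := fun k => by
        rw [Algebra.algebraMap_eq_smul_one, Matrix.mul_smul, Matrix.mul_one, Matrix.smul_mul, hP'P] }
  have hc : ∀ X, c X = P⁻¹ * X * P := fun _ => rfl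
  rw [← hc A, Polynomial.aeval_algHom_apply c A p, hc]

/-- `GL`-packaged form: for `φ : K[A] ≃ₐ[K] S` with `p_A` separable there is `g ∈ GL_m(K)` with `φ(x) = g x g⁻¹` on `K[A]`.
[cite: HornJohnson2013, 3.3.P12, p0258] -/
theorem exists_gl_conj_eq_algEquiv_adjoin (A : Matrix (Fin m) (Fin m) K) (hA : A.charpoly.Separable)
    (S : Subalgebra K (Matrix (Fin m) (Fin m) K))
    (φ : ↥(Algebra.adjoin K ({A} : Set (Matrix (Fin m) (Fin m) K))) ≃ₐ[K] ↥S) :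
    ∃ g : GL (Fin m) K,
      ∀ x : ↥(Algebra.adjoin K ({A} : Set (Matrix (Fin m) (Fin m) K))),
        ((φ x : ↥S) : Matrix (Fin m) (Fin m) K) = (g : Matrix (Fin m) (Fin m) K) * (x : Matrix (Fin m) (Fin m) K) * ((g⁻¹ : GL (Fin m) K) : Matrix (Fin m) (Fin m) K) := by
  obtain ⟨P, hP, h⟩ := exists_conj_eq_algEquiv_adjoin A hA S φ
  have hP' : IsUnit P⁻¹.det := Matrix.isUnit_nonsing_inv_det P hP
  refine ⟨Matrix.GeneralLinearGroup.mk'' P⁻¹ hP', fun x => ?_⟩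
  rw [h x]
  congr 1
  rw [Matrix.coe_units_inv]
  change P = (P⁻¹)⁻¹
  rw [Matrix.nonsing_inv_nonsing_inv P hP]

end Literature.LinearAlgebra.Matrix
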